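import Summits.HodgeConjecture.HodgeConjecture.Theses.CurveNetMordellWeil
import Literature.AlgebraicGeometry.HodgeTheory.SaitoGrFDeRhamCurveNet
import Literature.AlgebraicGeometry.HodgeTheory.GysinFormalismPushforward
import Literature.AlgebraicGeometry.Motives.FiberNetExistence
import HarnessLib

/-!
# Route CurveNetMordellWeil — crux `VerticalSupportMiddle`, line `tangential-carriers-period-syzygies`:
# the lever's surplus is vacuous, and the crux contains `C⁺` verbatim
(evidence for item stmt-HodgeConjecture-2782; helpers `--supports` it; lead prover, 2026-08-16)

The line skeleton `Cruxes/VerticalSupportMiddle/Lines/tangential_carriers_period_syzygies.lean` composes the crux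
from three registered stubs, `OddConiveauOne`, `SteinFreeTransfer : OddConiveauOne → NetVerticality →
GeneralVerticality` and the LEVER `TangentialCarrierLaw`: for a curve net `N` (`m + 1 = 2q ≥ 4`) and a rational
`(q,q)`-class `c` on the total space, *there is a non-zero admissible form `F₀` (`Δ ⊆ V(F₀)`) such that EITHER
`c` is supported on `π⁻¹V(F₀)` OR `c` is supported on `π⁻¹V(F₀·G)` for a TANGENTIAL CARRIER `V(G)` with `k ≥ 1`
isolated characteristic points*. Its advertised surplus over `NetVerticality` (= `C⁺`, vertical support on honest
nets: `∃ F ≠ 0, c` supported on `π⁻¹V(F)`) is the carrier structure of the second branch.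

This file proves, on the tree's real carriers and with no Hodge-theoretic input:

* `curveNet_exists_isAdmissibleForm_supset` — over `ℂ`, every proper Zariski-closed `T ⊊ ℙᵐ` lies in `V(F₀)` for a
  NON-ZERO ADMISSIBLE form `F₀` of the net (`T ∪ Δ` is a proper closed subset of the irreducible `ℙᵐ`, because
  `Δ ≠ ℙᵐ` by generic smoothness — the tree's `FiberNet.discriminant_ne_univ_of_charZero` — and proper closed sets
  lie on hypersurfaces, `exists_form_of_isClosed_of_ne_univ`).
* `curveNet_deltaVertical_of_vertical` — hence a class supported on `π⁻¹V(F)` for SOME `F ≠ 0` is supported on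
  `π⁻¹V(F₀)` for some non-zero ADMISSIBLE `F₀`: the first branch of the lever absorbs every vertical class, the
  tangential-carrier branch is never needed, and (with the skeleton's `netVerticality_of_law`)
  `TangentialCarrierLaw ↔ NetVerticality` — the lever is `C⁺` in carrier clothes (the skeleton-side `iff` is
  recorded in the lead's work file and dead-line note; it cannot live here because Theorems files do not import
  `Cruxes/`).
* `verticalSupportMiddle_imp_netVerticality` — conversely the crux AS TYPED, applied to the net's own projection
  `π : X̃ ⟶ ℙᵐ`, gives `NetVerticality` verbatim: the algebraic summand is vertical too, since a Zariski-closed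
  `Z ⊆ X̃` of codimension `≥ q` has image `π(Z)` of codimension `≥ q - 1 ≥ 1` in `ℙᵐ` (`le_coheight_of_mem_image`),
  a proper closed subset, and finitely many proper closed subsets of `ℙᵐ` do not cover it.

Together with the landed hardness theorem (`verticalSupportMiddle_imp_coniveau_one_odd`: crux ⟹ `OddConiveauOne`)
and the line's own composition (`OddConiveauOne + SteinFreeTransfer + NetVerticality ⟹ crux`), the crux as typed is
EXACTLY `OddConiveauOne ∧ NetVerticality` modulo the transfer, and the line's lever is the `NetVerticality` half
of the crux itself — no engine, no surplus.
-/

noncomputable section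

-- `Summit.HodgeConjecture.HodgeConjecture.Theorems` is the mandated namespace (single-problem summit: Problem =
-- Summit), which `linter.dupNamespace` flags; off tree-wide in the lakefile, restated for stand-alone elaboration.
set_option linter.dupNamespace false

open CategoryTheory AlgebraicGeometry
open Literature.AlgebraicGeometry Literature.AlgebraicGeometry.Motives Literature.AlgebraicGeometry.HodgeTheory
open Summit.HodgeConjecture.HodgeConjecture.Theses.CurveNetMordellWeil (VerticalSupportMiddle)

namespace Summit.HodgeConjecture.HodgeConjecture.Theorems

variable {m : ℕ} {X : SchemeOver ℂ}

/-- **Two proper Zariski-closed subsets of `ℙᵐ_ℂ` do not cover it** (`ℙᵐ` is irreducible: the tree's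
`isSmoothProjective_projectiveSpace_holds` + `IsSmoothProjective.isIntegral_holds`). -/
theorem projectiveSpace_union_ne_univ (m : ℕ) {T₁ T₂ : Set (projectiveSpace m ℂ).left} (h₁ : IsClosed T₁)
    (h₂ : IsClosed T₂) (h₁' : T₁ ≠ Set.univ) (h₂' : T₂ ≠ Set.univ) : T₁ ∪ T₂ ≠ Set.univ := by
  haveI : IsIntegral (projectiveSpace m ℂ).left :=
    IsSmoothProjective.isIntegral_holds (isSmoothProjective_projectiveSpace_holds ℂ m)
  intro h
  rcases (isPreirreducible_iff_isClosed_union_isClosed.mp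
      (PreirreducibleSpace.isPreirreducible_univ (X := ↥(projectiveSpace m ℂ).left)) T₁ T₂ h₁ h₂ h.symm.le)
    with hle | hle
  · exact h₁' (Set.eq_univ_of_univ_subset hle)
  · exact h₂' (Set.eq_univ_of_univ_subset hle)

/-- **Over `ℂ` the discriminant of a curve net is a proper closed subset of `ℙᵐ`** (generic smoothness, through the
tree's `FiberNet.discriminant_ne_univ_of_charZero` and `curveNetEquivFiberNet`). -/
theorem curveNet_discriminant_ne_univ (N : CurveNet m X) : N.discriminant ≠ Set.univ := by
  rw [← FiberNet.discriminant_toFiberNet]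
  exact N.toFiberNet.discriminant_ne_univ_of_charZero

/-- **Every proper closed `T ⊊ ℙᵐ` lies on a non-zero ADMISSIBLE hypersurface of the net**: there is a form
`F₀ ≠ 0`, homogeneous of degree `≥ 1`, with `Δ ⊆ V(F₀)` (`N.IsAdmissibleForm F₀`) and `T ⊆ V(F₀)` — apply
`exists_form_of_isClosed_of_ne_univ` to the proper closed `T ∪ Δ`. -/
theorem curveNet_exists_isAdmissibleForm_supset (N : CurveNet m X) {T : Set (projectiveSpace m ℂ).left}
    (hT : IsClosed T) (hTne : T ≠ Set.univ) :
    ∃ F₀ : MvPolynomial (Fin (m + 1)) ℂ, F₀ ≠ 0 ∧ N.IsAdmissibleForm F₀ ∧ T ⊆ projHypersurface m F₀ := by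
  obtain ⟨F, e, he, hFe, hF0, hsub⟩ := exists_form_of_isClosed_of_ne_univ m (hT.union N.isClosed_discriminant)
    (projectiveSpace_union_ne_univ m hT N.isClosed_discriminant hTne (curveNet_discriminant_ne_univ N))
  exact ⟨F, hF0, ⟨⟨e, he, hFe⟩, Set.subset_union_right.trans hsub⟩, Set.subset_union_left.trans hsub⟩

/-- **Every vertical class is Δ-vertical in the lever's sense.** If a class `c ∈ Hᵏ(X̃(ℂ); ℂ)` is supported on
`π⁻¹V(F)` for some polynomial `F ≠ 0`, then it is supported on `π⁻¹V(F₀)` for a NON-ZERO ADMISSIBLE form `F₀`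
(`Δ ⊆ V(F₀)`): take `V(F₀) ⊇ V(F) ∪ Δ`. Consequently the first branch of the line's `TangentialCarrierLaw`
absorbs every class that `NetVerticality` makes vertical, and the law's tangential-carrier branch is never
exercised: `TangentialCarrierLaw ↔ NetVerticality`. -/
theorem curveNet_deltaVertical_of_vertical :
    ∀ {m : ℕ} {X : SchemeOver ℂ} (N : CurveNet m X) {F : MvPolynomial (Fin (m + 1)) ℂ}, F ≠ 0 →
      ∀ {k : ℕ} {c : complexBetti N.total k},
        c ∈ classesSupportedOn N.total (N.proj.left.base ⁻¹' projHypersurface m F) k →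
          ∃ F₀ : MvPolynomial (Fin (m + 1)) ℂ, F₀ ≠ 0 ∧ N.IsAdmissibleForm F₀ ∧
            c ∈ classesSupportedOn N.total (N.proj.left.base ⁻¹' projHypersurface m F₀) k := by
  intro m X N F hF k c hc
  obtain ⟨F₀, hF₀, hadm, hsub⟩ := curveNet_exists_isAdmissibleForm_supset N (isClosed_projHypersurface m F)
    (projHypersurface_ne_univ m hF)
  exact ⟨F₀, hF₀, hadm, classesSupportedOn_mono (Set.preimage_mono hsub) k hc⟩

/-- **The image under `π` of a closed subset of codimension `≥ q` of the total space is a proper closed subset of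
`ℙᵐ`** (`m + 1 = 2q`, `q ≥ 2`): `π` is proper hence closed, and its points have codimension `≥ q - 1 ≥ 1`
(`le_coheight_of_mem_image`), whereas the generic point of `ℙᵐ` has codimension `0`. -/
theorem curveNet_image_proj_ne_univ (N : CurveNet m X) {q : ℕ} (hq : 2 ≤ q) (hm : m + 1 = 2 * q)
    {Z : Set N.total.left} (hZ : IsClosed Z) (hcoh : ∀ z ∈ Z, (q : ℕ∞) ≤ Order.coheight z) :
    IsClosed (N.proj.left.base '' Z) ∧ N.proj.left.base '' Z ≠ Set.univ := by
  have hcl : IsClosedMap N.proj.left.base := by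
    haveI := N.isProper_proj
    exact N.proj.left.isClosedMap
  refine ⟨hcl _ hZ, fun h => ?_⟩
  haveI : IsIntegral (projectiveSpace m ℂ).left :=
    IsSmoothProjective.isIntegral_holds (isSmoothProjective_projectiveSpace_holds ℂ m)
  have hη : genericPoint (projectiveSpace m ℂ).left ∈ N.proj.left.base '' Z := h ▸ Set.mem_univ _
  have h1 : ((1 : ℕ) : ℕ∞) ≤ Order.coheight (genericPoint (projectiveSpace m ℂ).left) :=
    le_coheight_of_mem_image N.isSmoothProjective_total (isSmoothProjective_projectiveSpace_holds ℂ m) N.proj hcl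
      hcoh (by omega) hη
  have h0 : Order.coheight (genericPoint (projectiveSpace m ℂ).left) = 0 :=
    Order.coheight_eq_zero.2 fun y _ ↦ Scheme.le_iff_specializes.2 (genericPoint_specializes y)
  rw [h0] at h1
  exact absurd h1 (by norm_num)

/-- **The crux AS TYPED contains `C⁺` (`NetVerticality`) verbatim.** Apply `VerticalSupportMiddle` to the net's
own (surjective) projection `π : X̃ ⟶ ℙᵐ` on the smooth projective `2q`-fold `X̃ = N.total`: a rational
`(q,q)`-class `c` lies in `algebraicClasses X̃ q ⊔ span{classes dying off π⁻¹T, T ⊊ ℙᵐ closed}`; the classes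
dying off `π⁻¹T` for SOME proper closed `T` form a submodule (finite unions of proper closed subsets of the
irreducible `ℙᵐ` are proper), which contains the second summand by definition and the first because a class
supported on a closed `Z` of codimension `≥ q` dies off `π⁻¹(π Z)` with `π Z ⊊ ℙᵐ` proper closed
(`curveNet_image_proj_ne_univ`); finally a proper closed `T` lies on a hypersurface `V(F)`, `F ≠ 0`. -/
theorem verticalSupportMiddle_imp_netVerticality :
    VerticalSupportMiddle → ∀ ⦃q m : ℕ⦄ ⦃X : SchemeOver ℂ⦄ (N : CurveNet m X), 2 ≤ q → m + 1 = 2 * q →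
      ∀ c : complexBetti N.total (2 * q), IsRationalClass c → IsOfHodgeType (m + 1) N.total (2 * q) q q c →
        ∃ F : MvPolynomial (Fin (m + 1)) ℂ, F ≠ 0 ∧
          c ∈ classesSupportedOn N.total (N.proj.left.base ⁻¹' projHypersurface m F) (2 * q) := by
  intro h q m X N hq hm c hc hh
  -- the submodule of classes vertical over SOME proper closed subset of the base
  let S : Submodule ℂ (complexBetti N.total (2 * q)) :=
    { carrier := {x | ∃ T : Set (projectiveSpace m ℂ).left, IsClosed T ∧ T ≠ Set.univ ∧
          x ∈ classesSupportedOn N.total (N.proj.left.base ⁻¹' T) (2 * q)}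
      zero_mem' := by
        haveI := N.nonempty_base
        exact ⟨∅, isClosed_empty, Set.empty_ne_univ, Submodule.zero_mem _⟩
      add_mem' := by
        rintro a b ⟨T₁, hT₁, hT₁', ha⟩ ⟨T₂, hT₂, hT₂', hb⟩
        refine ⟨T₁ ∪ T₂, hT₁.union hT₂, projectiveSpace_union_ne_univ m hT₁ hT₂ hT₁' hT₂', ?_⟩
        exact Submodule.add_mem _
          (classesSupportedOn_mono (Set.preimage_mono Set.subset_union_left) _ ha)
          (classesSupportedOn_mono (Set.preimage_mono Set.subset_union_right) _ hb)
      smul_mem' := by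
        rintro t a ⟨T, hT, hT', ha⟩
        exact ⟨T, hT, hT', Submodule.smul_mem _ t ha⟩ }
  have hX2 : IsSmoothProjective (2 * q) N.total := by
    rw [← hm]
    exact N.isSmoothProjective_total
  have hh2 : IsOfHodgeType (2 * q) N.total (2 * q) q q c := by
    convert hh using 1
    exact hm.symm
  have hcmem := h N.proj hX2 hq hm N.surjective_proj (Submodule.subset_span ⟨hc, hh2⟩)
  -- the algebraic summand is vertical
  have h1 : algebraicClasses N.total q ≤ S := by
    refine iSup_le fun Z => iSup_le fun hZ => iSup_le fun hcoh => ?_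
    intro x hx
    obtain ⟨hcl, hne⟩ := curveNet_image_proj_ne_univ N hq hm hZ hcoh
    refine ⟨N.proj.left.base '' Z, hcl, hne, ?_⟩
    exact classesSupportedOn_mono (Set.subset_preimage_image _ Z) _ hx
  -- the vertical summand is vertical
  have h2 : Submodule.span ℂ {c : complexBetti N.total (2 * q) | IsRationalClass c ∧
      IsOfHodgeType (2 * q) N.total (2 * q) q q c ∧ ∃ T : Set (projectiveSpace m ℂ).left,
        IsClosed T ∧ T ≠ Set.univ ∧ complexBetti.restrictCompl N.total (N.proj.left.base ⁻¹' T) (2 * q) c = 0}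
      ≤ S := by
    refine Submodule.span_le.2 ?_
    rintro x ⟨-, -, T, hT, hTne, hx⟩
    exact ⟨T, hT, hTne, mem_classesSupportedOn_iff.2 hx⟩
  obtain ⟨T, hT, hTne, hcT⟩ := (sup_le h1 h2) hcmem
  obtain ⟨F, e, -, -, hF0, hsub⟩ := exists_form_of_isClosed_of_ne_univ m hT hTne
  exact ⟨F, hF0, classesSupportedOn_mono (Set.preimage_mono hsub) _ hcT⟩

end Summit.HodgeConjecture.HodgeConjecture.Theorems

end
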